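import Literature.NumberTheory.Automorphic.InfUnitaryOneParameterGroupDeriv
import Literature.Analysis.Calculus.TaylorFlatnessDerivFamily
import Mathlib.Analysis.InnerProductSpace.Calculus
import Mathlib.LinearAlgebra.Basis.VectorSpace
import HarnessLib

/-!
# The weak `Ad`-identity along a one-parameter unitary group integrating a `(𝔤, K)`-module:
# `⟪U_Y(s) ι(ρ(Ad(e^{−sY}) X) v), ι w⟫ = −⟪U_Y(s) ι v, ι(ρ(X) w)⟫`

Topic `NumberTheory/Automorphic`; namespace `Literature.NumberTheory.Automorphic.IsPosDefHerm` (sequel of ★ `InfUnitaryOneParameterGroup` ∕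
★ `InfUnitaryOneParameterGroupDeriv`: the unitary one-parameter groups `hB.U ρ K X s` on the completion `hB.E` of a module `V` with positive definite
hermitian form `B`, built from the factorial bounds (FB) of a `(𝔤, K)`-module — (U1) `U_add`, (U2) `U_mem_unitary`, (U4) `hasDerivAt_U_emb`).
THEOREMS ONLY; no definition, no instance, no notation, no named fact, no `sorry`.  Cell `hodgecm-mathlib`, F0∕P3, in-house road to the letter A6
`HasUnitaryGlobalizationOfInfUnitary` at `U(2,1)` (ROAD-GLOB v1.1, brick P3, T1a LEAD F0P3b-p01 (g3)).

THE MATHEMATICS ([HarishChandra1953, §9, proof of Lemma 28 ∕ Thm. 8]; [Nelson1959, §2]).  Let `ρ : 𝔤 → End(V)` be a real Lie algebra action by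
`B`-skew operators with the factorial bound (FB) `‖ι(ρ(X₁)⋯ρ(X_m) v)‖ ≤ C_v m! K^m ∏‖X_i‖`, `ι = hB.emb`, and `U_Y(s) = hB.U ρ K Y s` the unitary group with
`d/ds U_Y(s) ι v = U_Y(s) ι(ρ(Y) v)`.  Then for all `X, Y ∈ 𝔤`, `s ∈ ℝ`, `v, w ∈ V`:

  **`⟪U_Y(s) ι(ρ(Ad(exp(−sY)) X) v), ι w⟫ = −⟪U_Y(s) ι v, ι(ρ(X) w)⟫`**   (`inner_U_emb_Ad`),

i.e. WEAKLY on `ι V × ι V`, `U_Y(s)⁻¹ ρ(X) U_Y(s) = ρ(Ad(exp(−sY)) X)` — the identity a genuine representation `Φ` with `Φ(exp sY) = U_Y(s)` satisfies, proved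
here WITHOUT the representation: the family `f_v(s) :=` LHS `+ ⟪U_Y(s) ι v, ι(ρ X w)⟫` vanishes at `s = 0` (skewness), satisfies `f_v' = f_{ρ(Y)v}` (product rule,
`d/ds Ad(e^{−sY})X = −[Y, Ad(e^{−sY})X]`, `ρ` a Lie homomorphism, and the WEAK SKEWNESS OF THE GENERATOR `⟪U_Y(s) ι(ρ Y x), ι y⟫ = −⟪U_Y(s) ι x, ι(ρ Y y)⟫`,
`inner_U_emb_generator`), and obeys uniform-radius factorial bounds on every bounded interval (FB), so the Taylor engine ★ `TaylorFlatnessDerivFamily`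
kills it.  Consumer: brick Φ2 (torus translation law of the globalization), where `X ∈ 𝔨` is the logarithmic derivative of the `K`-part of a `KAK` section.

## Main statements
* `U_neg_comp_U`, `U_comp_U_neg`, `inner_U_apply_left` — `U(−s) = U(s)⁻¹ = U(s)†` on inner products;
* `inner_U_emb_generator` — weak skewness of the generator along the group;
* `hasDerivAt_coe_Ad_expMem_neg` — `d/ds Ad(exp(−sY)) X = −[Y, Ad(exp(−sY)) X]` (matrix level);
* **`inner_U_emb_Ad`** — the weak `Ad`-identity.

## Mathlib ∕ tree search
Tree: ★ `hB.U`, `U_add`, `U_zero`, `U_mem_unitary`, `hasDerivAt_U_emb`, `lineBound_of_FB` (A-p14 (g24)); ★ `eqOn_zero_of_hasDerivAt_family_of_factorial_bound`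
(A′); ★ `inner_emb_emb`, `inner_emb_map_eq_neg` (G0); ★ `RealMatrixGroup.Ad_apply_coe`, `coe_expMem`, `expGL_neg`, `coe_expGL`.  Mathlib: `HasDerivAt.inner`,
`ContinuousLinearMap.inner_map_map_of_mem_unitary`, `hasDerivAt_exp_smul_const`, `LinearMap.exists_extend`, `LinearMap.toContinuousLinearMap`,
`IsCompact.exists_bound_of_continuousOn`.  Dedup: `rg "inner_U_emb_Ad|WeakAdIdentity" Literature/` — no hits.

## References
* Harish-Chandra, *Representations of a semisimple Lie group on a Banach space. I*, Trans. AMS 75 (1953), §9 [HarishChandra1953].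
* E. Nelson, *Analytic vectors*, Ann. of Math. 70 (1959), §2 [Nelson1959].
-/

set_option autoImplicit false

noncomputable section

-- Mathlib idiom (as in ★ `GKModules`): the commutator bracket on associative algebras, to mention `G.lie →ₗ⁅ℝ⁆ Module.End ℂ V`.
attribute [local instance 100] LieRing.ofAssociativeRing

open Finset Set Filter
open scoped Nat InnerProductSpace ComplexConjugate Matrix.Norms.Operator Topology

namespace Literature.NumberTheory.Automorphic

namespace IsPosDefHerm

universe u

variable {A : Type*} [NormedCommRing A] [NormedAlgebra ℝ A] [NormedAlgebra ℚ A] [CompleteSpace A]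
  [StarRing A] {N : Type*} [Fintype N] [DecidableEq N] {G : RealMatrixGroup A N}
  {V : Type u} [AddCommGroup V] [Module ℂ V] {B : V →ₗ⋆[ℂ] V →ₗ[ℂ] ℂ} (hB : IsPosDefHerm B)
include hB

variable {ρ : G.lie →ₗ⁅ℝ⁆ Module.End ℂ V}

/-! ## §1 `U(−s) = U(s)⁻¹` and the adjoint on inner products -/

/-- `U(−s) ∘ U(s) = 1`. [cite: HarishChandra1953, §9] -/
theorem U_neg_comp_U {K : ℝ} (hK : 0 ≤ K) {X : G.lie} (hX : ∀ x y, B (ρ X x) y = -B x (ρ X y))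
    (hb : ∀ v : V, ∃ C : ℝ, ∀ n, ‖hB.emb (((ρ X : V →ₗ[ℂ] V) ^ n) v)‖ ≤ C * n ! * (K * ‖(X : Matrix N N A)‖) ^ n) (s : ℝ) :
    hB.U ρ K X (-s) ∘L hB.U ρ K X s = 1 := by
  rw [← hB.U_add hK hX hb, neg_add_cancel, hB.U_zero hK hX hb]

/-- `U(s) ∘ U(−s) = 1`. [cite: HarishChandra1953, §9] -/
theorem U_comp_U_neg {K : ℝ} (hK : 0 ≤ K) {X : G.lie} (hX : ∀ x y, B (ρ X x) y = -B x (ρ X y))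
    (hb : ∀ v : V, ∃ C : ℝ, ∀ n, ‖hB.emb (((ρ X : V →ₗ[ℂ] V) ^ n) v)‖ ≤ C * n ! * (K * ‖(X : Matrix N N A)‖) ^ n) (s : ℝ) :
    hB.U ρ K X s ∘L hB.U ρ K X (-s) = 1 := by
  rw [← hB.U_add hK hX hb, add_neg_cancel, hB.U_zero hK hX hb]

/-- **`U(s)† = U(−s)` on inner products**: `⟪U(s) x, y⟫ = ⟪x, U(−s) y⟫`. [cite: HarishChandra1953, §9] -/
theorem inner_U_apply_left {K : ℝ} (hK : 0 ≤ K) {X : G.lie} (hX : ∀ x y, B (ρ X x) y = -B x (ρ X y))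
    (hb : ∀ v : V, ∃ C : ℝ, ∀ n, ‖hB.emb (((ρ X : V →ₗ[ℂ] V) ^ n) v)‖ ≤ C * n ! * (K * ‖(X : Matrix N N A)‖) ^ n) (s : ℝ) (x y : hB.E) :
    ⟪hB.U ρ K X s x, y⟫_ℂ = ⟪x, hB.U ρ K X (-s) y⟫_ℂ := by
  have hy : y = hB.U ρ K X s (hB.U ρ K X (-s) y) := by
    rw [← ContinuousLinearMap.comp_apply, hB.U_comp_U_neg hK hX hb]; rfl
  conv_lhs => rw [hy]
  exact ContinuousLinearMap.inner_map_map_of_mem_unitary (hB.U_mem_unitary hK hX hb s) _ _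

/-! ## §2 Weak skewness of the generator along the group -/

/-- **`⟪U(s) ι(ρ X x), ι y⟫ = −⟪U(s) ι x, ι(ρ X y)⟫`**: both sides are the derivative at `s` of `t ↦ ⟪U(t) ι x, ι y⟫ = ⟪ι x, U(−t) ι y⟫` (U4). [cite: HarishChandra1953, §9] -/
theorem inner_U_emb_generator {K : ℝ} (hK : 0 < K) {X : G.lie} (hX : ∀ x y, B (ρ X x) y = -B x (ρ X y))
    (hb : ∀ v : V, ∃ C : ℝ, ∀ n, ‖hB.emb (((ρ X : V →ₗ[ℂ] V) ^ n) v)‖ ≤ C * n ! * (K * ‖(X : Matrix N N A)‖) ^ n) (s : ℝ) (x y : V) :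
    ⟪hB.U ρ K X s (hB.emb (ρ X x)), hB.emb y⟫_ℂ = -⟪hB.U ρ K X s (hB.emb x), hB.emb (ρ X y)⟫_ℂ := by
  -- first computation of the derivative of `t ↦ ⟪U t (ι x), ι y⟫`
  have h1 : HasDerivAt (fun t : ℝ => ⟪hB.U ρ K X t (hB.emb x), hB.emb y⟫_ℂ) (⟪hB.U ρ K X s (hB.emb (ρ X x)), hB.emb y⟫_ℂ) s := by
    have h := (hB.hasDerivAt_U_emb hK hX hb x s).inner ℂ (hasDerivAt_const s (hB.emb y))
    simpa using h
  -- second computation through `⟪ι x, U(−t) ι y⟫`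
  have h2 : HasDerivAt (fun t : ℝ => ⟪hB.U ρ K X t (hB.emb x), hB.emb y⟫_ℂ) (-⟪hB.U ρ K X s (hB.emb x), hB.emb (ρ X y)⟫_ℂ) s := by
    have hfun : (fun t : ℝ => ⟪hB.U ρ K X t (hB.emb x), hB.emb y⟫_ℂ) = fun t : ℝ => ⟪hB.emb x, hB.U ρ K X (-t) (hB.emb y)⟫_ℂ := by
      funext t; exact hB.inner_U_apply_left hK.le hX hb t _ _
    rw [hfun]
    have hg : HasDerivAt (fun t : ℝ => hB.U ρ K X (-t) (hB.emb y)) ((-1 : ℝ) • hB.U ρ K X (-s) (hB.emb (ρ X y))) s := by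
      have h := (hB.hasDerivAt_U_emb hK hX hb y (-s)).scomp s (hasDerivAt_neg s)
      simpa [Function.comp_def] using h
    have h := (hasDerivAt_const s (hB.emb x)).inner ℂ hg
    simp only [inner_zero_left, add_zero, neg_smul, one_smul, inner_neg_right] at h
    rw [← hB.inner_U_apply_left hK.le hX hb s] at h
    exact h
  exact h1.unique h2

/-! ## §3 The curve `s ↦ Ad(exp(−sY)) X` and its derivative -/

omit [AddCommGroup V] [Module ℂ V] hB in
/-- The matrix of `Ad(exp(−sY)) X` is `e^{−sY} X e^{sY}`. [cite: Knapp2002, I §10 (1.83)] -/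
theorem coe_Ad_expMem_neg (Y X : G.lie) (s : ℝ) :
    ((G.Ad (G.expMem ((-s) • Y)) X : G.lie) : Matrix N N A) =
      NormedSpace.exp ((-s) • (Y : Matrix N N A)) * (X : Matrix N N A) * NormedSpace.exp (s • (Y : Matrix N N A)) := by
  rw [RealMatrixGroup.Ad_apply_coe, RealMatrixGroup.coe_expMem, ← expGL_neg, coe_expGL, coe_expGL]
  congr 2
  rw [show (((-s) • Y : G.lie) : Matrix N N A) = (-s) • (Y : Matrix N N A) from rfl, neg_smul, neg_neg]

omit [AddCommGroup V] [Module ℂ V] hB in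
set_option backward.isDefEq.respectTransparency false in
/-- **`d/ds Ad(exp(−sY)) X = −[Y, Ad(exp(−sY)) X]`** (matrix level). [cite: Knapp2002, I §10 Prop. 1.89] -/
theorem hasDerivAt_coe_Ad_expMem_neg (Y X : G.lie) (s : ℝ) :
    HasDerivAt (fun t : ℝ => ((G.Ad (G.expMem ((-t) • Y)) X : G.lie) : Matrix N N A))
      (-(((Y : Matrix N N A) * ((G.Ad (G.expMem ((-s) • Y)) X : G.lie) : Matrix N N A) -
        ((G.Ad (G.expMem ((-s) • Y)) X : G.lie) : Matrix N N A) * (Y : Matrix N N A)))) s := by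
  simp only [coe_Ad_expMem_neg]
  set Ym : Matrix N N A := (Y : Matrix N N A)
  set Xm : Matrix N N A := (X : Matrix N N A)
  -- derivatives of the two exponential factors
  have hminus : HasDerivAt (fun t : ℝ => NormedSpace.exp ((-t) • Ym)) (-(Ym * NormedSpace.exp ((-s) • Ym))) s := by
    have h := (hasDerivAt_exp_smul_const' (𝕂 := ℝ) Ym (-s)).scomp s (hasDerivAt_neg s)
    simpa [Function.comp_def] using h
  have hplus : HasDerivAt (fun t : ℝ => NormedSpace.exp (t • Ym)) (NormedSpace.exp (s • Ym) * Ym) s :=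
    hasDerivAt_exp_smul_const (𝕂 := ℝ) Ym s
  have h := (hminus.mul_const Xm).mul hplus
  refine h.congr_deriv ?_
  noncomm_ring

/-! ## §4 The weak `Ad`-identity -/

omit [AddCommGroup V] [Module ℂ V] hB in
/-- `(n+1) xⁿ ≤ (2x+1)ⁿ` for `x ≥ 0` (absorbing a linear factor into the radius). [cite: Nelson1959, §2] -/
theorem succ_mul_pow_le_pow (x : ℝ) (hx : 0 ≤ x) (n : ℕ) : (n + 1 : ℝ) * x ^ n ≤ (2 * x + 1) ^ n := by
  have h1n : n + 1 ≤ 2 ^ n := Nat.lt_two_pow_self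
  have h1 : (n + 1 : ℝ) ≤ 2 ^ n := by exact_mod_cast h1n
  calc (n + 1 : ℝ) * x ^ n ≤ 2 ^ n * x ^ n := by gcongr
    _ = (2 * x) ^ n := by rw [mul_pow]
    _ ≤ (2 * x + 1) ^ n := by gcongr; linarith

set_option maxHeartbeats 400000 in
/-- **THE WEAK `Ad`-IDENTITY.**  For a real Lie algebra action `ρ` by `B`-skew operators with the factorial bound (FB) at constant `K > 0`, and the unitary
one-parameter groups `U_Y(s) = hB.U ρ K Y s` of ★ `InfUnitaryOneParameterGroup`: for all `X Y ∈ 𝔤`, `s ∈ ℝ`, `v w ∈ V`,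
`⟪U_Y(s) ι(ρ(Ad(exp(−sY)) X) v), ι w⟫ = −⟪U_Y(s) ι v, ι(ρ X w)⟫`. [cite: HarishChandra1953, §9] [cite: Nelson1959, §2] -/
theorem inner_U_emb_Ad [FiniteDimensional ℝ A] {K : ℝ} (hK : 0 < K) (hskew : ∀ (X : G.lie) (x y : V), B (ρ X x) y = -B x (ρ X y))
    (hFB : ∀ v : V, ∃ C : ℝ, ∀ (m : ℕ) (X : Fin m → G.lie),
      ‖hB.emb ((List.ofFn fun i => (ρ (X i) : V →ₗ[ℂ] V)).prod v)‖ ≤ C * m ! * K ^ m * ∏ i, ‖((X i : G.lie) : Matrix N N A)‖)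
    (Y X : G.lie) (s : ℝ) (v w : V) :
    ⟪hB.U ρ K Y s (hB.emb (ρ (G.Ad (G.expMem ((-s) • Y)) X) v)), hB.emb w⟫_ℂ = -⟪hB.U ρ K Y s (hB.emb v), hB.emb (ρ X w)⟫_ℂ := by
  have hbY := hB.lineBound_of_FB ρ hFB Y
  -- notation
  set Ad : ℝ → G.lie := fun t => G.Ad (G.expMem ((-t) • Y)) X with hAd
  set f : V → ℝ → ℂ := fun u t =>
    ⟪hB.U ρ K Y t (hB.emb (ρ (Ad t) u)), hB.emb w⟫_ℂ + ⟪hB.U ρ K Y t (hB.emb u), hB.emb (ρ X w)⟫_ℂ with hf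
  suffices hzero : f v s = 0 by
    have : ⟪hB.U ρ K Y s (hB.emb (ρ (Ad s) v)), hB.emb w⟫_ℂ + ⟪hB.U ρ K Y s (hB.emb v), hB.emb (ρ X w)⟫_ℂ = 0 := hzero
    exact eq_neg_of_add_eq_zero_left this
  -- an ℝ-linear extension `Λ_u` of `Z ↦ ι(ρ Z u)` to all matrices (to differentiate along the matrix curve `Ad t`)
  have hΛ : ∀ u : V, ∃ Λ : Matrix N N A →L[ℝ] hB.E, ∀ Z : G.lie, Λ (Z : Matrix N N A) = hB.emb (ρ Z u) := by
    intro u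
    let l : G.lie.toSubmodule →ₗ[ℝ] hB.E :=
      { toFun := fun Z => hB.emb (ρ ⟨Z, Z.2⟩ u)
        map_add' := fun Z Z' => by
          have : (⟨(Z : Matrix N N A) + Z', (Z + Z').2⟩ : G.lie) = ⟨Z, Z.2⟩ + ⟨Z', Z'.2⟩ := rfl
          simp only [Submodule.coe_add, this, map_add, LinearMap.add_apply]
        map_smul' := fun c Z => by
          have : (⟨c • (Z : Matrix N N A), (c • Z).2⟩ : G.lie) = c • ⟨Z, Z.2⟩ := rfl
          simp only [Submodule.coe_smul, this, map_smul, LinearMap.smul_apply, RingHom.id_apply]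
          rw [LinearMap.map_smul_of_tower] }
    obtain ⟨Λ, hΛ⟩ := LinearMap.exists_extend l
    refine ⟨LinearMap.toContinuousLinearMap Λ, fun Z => ?_⟩
    have h := LinearMap.congr_fun hΛ ⟨(Z : Matrix N N A), Z.2⟩
    simpa [l] using h
  -- (0) vanishing at `0`
  have h0 : ∀ u, f u 0 = 0 := by
    intro u
    have hAd0 : Ad 0 = X := by
      simp only [hAd, neg_zero, zero_smul]
      apply Subtype.ext
      rw [RealMatrixGroup.Ad_apply_coe, RealMatrixGroup.coe_expMem, ZeroMemClass.coe_zero, expGL_zero]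
      simp
    simp only [hf, hAd0, hB.U_zero hK.le (hskew Y) hbY, ContinuousLinearMap.one_def, ContinuousLinearMap.coe_id', id_eq]
    rw [hB.inner_emb_map_eq_neg (hskew X), neg_add_cancel]
  -- (i) the derivative identity `(f u)' = f (ρ Y u)`
  have hder : ∀ u t, HasDerivAt (f u) (f (ρ Y u) t) t := by
    intro u t
    obtain ⟨Λ, hΛ⟩ := hΛ u
    -- term 1: `⟪Λ (Ad t), U(−t) ι w⟫`
    have hA : HasDerivAt (fun t => Λ ((Ad t : G.lie) : Matrix N N A))
        (Λ (-(((Y : Matrix N N A) * ((Ad t : G.lie) : Matrix N N A) - ((Ad t : G.lie) : Matrix N N A) * (Y : Matrix N N A))))) t :=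
      (Λ.hasFDerivAt.comp_hasDerivAt t (hasDerivAt_coe_Ad_expMem_neg Y X t))
    have hbr : Λ (-(((Y : Matrix N N A) * ((Ad t : G.lie) : Matrix N N A) - ((Ad t : G.lie) : Matrix N N A) * (Y : Matrix N N A)))) =
        hB.emb (ρ (-⁅Y, Ad t⁆) u) := by
      rw [← hΛ]
      congr 1
    have hg1 : HasDerivAt (fun t : ℝ => hB.U ρ K Y (-t) (hB.emb w)) ((-1 : ℝ) • hB.U ρ K Y (-t) (hB.emb (ρ Y w))) t := by
      have h := (hB.hasDerivAt_U_emb hK (hskew Y) hbY w (-t)).scomp t (hasDerivAt_neg t)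
      simpa [Function.comp_def] using h
    have hg2 : HasDerivAt (fun t : ℝ => hB.U ρ K Y (-t) (hB.emb (ρ X w))) ((-1 : ℝ) • hB.U ρ K Y (-t) (hB.emb (ρ Y (ρ X w)))) t := by
      have h := (hB.hasDerivAt_U_emb hK (hskew Y) hbY (ρ X w) (-t)).scomp t (hasDerivAt_neg t)
      simpa [Function.comp_def] using h
    have hT1 := hA.inner ℂ hg1
    have hT2 := (hasDerivAt_const t (hB.emb u)).inner ℂ hg2
    -- rewrite `f u` in adjoint form
    have hfu : f u = fun t => ⟪Λ ((Ad t : G.lie) : Matrix N N A), hB.U ρ K Y (-t) (hB.emb w)⟫_ℂ +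
        ⟪hB.emb u, hB.U ρ K Y (-t) (hB.emb (ρ X w))⟫_ℂ := by
      funext t
      simp only [hf, hΛ, hB.inner_U_apply_left hK.le (hskew Y) hbY t]
    rw [hfu]
    refine (hT1.add hT2).congr_deriv ?_
    -- evaluate the derivative: back to `U(t)` on the left, weak skewness, Lie homomorphism
    have hlie : hB.emb (ρ (-⁅Y, Ad t⁆) u) = -hB.emb (ρ Y (ρ (Ad t) u)) + hB.emb (ρ (Ad t) (ρ Y u)) := by
      rw [map_neg, LieHom.map_lie, LinearMap.neg_apply, Ring.lie_def]
      simp only [Module.End.mul_apply, LinearMap.sub_apply, map_neg, map_sub]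
      abel
    have hadj : ∀ x y : hB.E, ⟪x, hB.U ρ K Y (-t) y⟫_ℂ = ⟪hB.U ρ K Y t x, y⟫_ℂ := fun x y =>
      (hB.inner_U_apply_left hK.le (hskew Y) hbY t x y).symm
    have hsk1 := hB.inner_U_emb_generator hK (hskew Y) hbY t (ρ (Ad t) u) w
    have hsk2 := hB.inner_U_emb_generator hK (hskew Y) hbY t u (ρ X w)
    rw [hbr.trans hlie]
    simp only [hf, hΛ, hadj, map_add, map_neg, map_zero, inner_add_left, inner_neg_left, inner_neg_right, neg_smul, one_smul,
      inner_zero_left, add_zero]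
    linear_combination -hsk1 - hsk2
  -- (ii) uniform-radius factorial bounds on a bounded interval
  set R : ℝ := |s| + 1 with hR
  have hsR : s ∈ Ioo (-R) R := by constructor <;> [linarith [neg_abs_le s]; linarith [le_abs_self s]]
  -- a bound for `‖Ad t‖` on `[−R, R]`
  have hAdcont : Continuous fun t : ℝ => ((Ad t : G.lie) : Matrix N N A) :=
    continuous_iff_continuousAt.2 fun t => (hasDerivAt_coe_Ad_expMem_neg Y X t).continuousAt
  obtain ⟨NR, hNR⟩ := isCompact_Icc.exists_bound_of_continuousOn (hAdcont.continuousOn (s := Icc (-R) R))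
  have hNR0 : 0 ≤ NR := (norm_nonneg _).trans (hNR 0 ⟨by linarith [abs_nonneg s], by linarith [abs_nonneg s]⟩)
  set L : ℝ := K * ‖(Y : Matrix N N A)‖ with hL
  have hL0 : 0 ≤ L := by positivity
  set r : ℝ := (2 * L + 1)⁻¹ with hr
  have hr0 : 0 < r := by positivity
  have hbd : ∀ u : V, ∃ M : ℝ, ∀ n : ℕ, ∀ t ∈ Ioo (-R) R, ‖f ((fun x => ρ Y x)^[n] u) t‖ ≤ M * n ! / r ^ n := by
    intro u
    obtain ⟨C, hC⟩ := hFB u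
    obtain ⟨C', hC'⟩ := hbY u
    have hC0 : 0 ≤ C := by
      have h := hC 0 Fin.elim0
      simp only [List.ofFn_zero, List.prod_nil, Nat.factorial_zero, Nat.cast_one, pow_zero, mul_one,
        Finset.univ_eq_empty, Finset.prod_empty] at h
      exact (norm_nonneg _).trans h
    have hC'0 : 0 ≤ C' := by
      have h := hC' 0
      simp only [pow_zero, Nat.factorial_zero, Nat.cast_one, mul_one, Module.End.one_apply] at h
      exact (norm_nonneg _).trans h
    refine ⟨(C * K * NR * ‖hB.emb w‖ + C' * ‖hB.emb (ρ X w)‖), fun n t ht => ?_⟩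
    have htI : t ∈ Icc (-R) R := ⟨ht.1.le, ht.2.le⟩
    have hAt : ‖((Ad t : G.lie) : Matrix N N A)‖ ≤ NR := hNR t htI
    -- iterate = power
    have hiter : (fun x => ρ Y x)^[n] u = ((ρ Y : V →ₗ[ℂ] V) ^ n) u := by
      rw [Module.End.pow_apply]
    -- the word `(Ad t, Y, …, Y)`
    have hword : ‖hB.emb (ρ (Ad t) (((ρ Y : V →ₗ[ℂ] V) ^ n) u))‖ ≤ C * (n + 1)! * K ^ (n + 1) * (‖((Ad t : G.lie) : Matrix N N A)‖ * ‖(Y : Matrix N N A)‖ ^ n) := by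
      have h := hC (n + 1) (Fin.cons (Ad t) (fun _ => Y))
      rw [List.ofFn_succ, List.prod_cons, Fin.prod_univ_succ] at h
      simp only [Fin.cons_zero, Fin.cons_succ, List.ofFn_const, List.prod_replicate, Finset.prod_const, Finset.card_univ,
        Fintype.card_fin] at h
      exact h
    have hline : ‖hB.emb (((ρ Y : V →ₗ[ℂ] V) ^ n) u)‖ ≤ C' * n ! * L ^ n := hC' n
    -- Cauchy–Schwarz and unitarity
    have hU1 : ‖hB.U ρ K Y t (hB.emb (ρ (Ad t) (((ρ Y : V →ₗ[ℂ] V) ^ n) u)))‖ = ‖hB.emb (ρ (Ad t) (((ρ Y : V →ₗ[ℂ] V) ^ n) u))‖ :=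
      hB.norm_U hK.le (hskew Y) hbY t _
    have hU2 : ‖hB.U ρ K Y t (hB.emb (((ρ Y : V →ₗ[ℂ] V) ^ n) u))‖ = ‖hB.emb (((ρ Y : V →ₗ[ℂ] V) ^ n) u)‖ :=
      hB.norm_U hK.le (hskew Y) hbY t _
    have hfac : ((n + 1)! : ℝ) = (n + 1) * n ! := by rw [Nat.factorial_succ, Nat.cast_mul]; push_cast; ring
    calc ‖f ((fun x => ρ Y x)^[n] u) t‖
        = ‖⟪hB.U ρ K Y t (hB.emb (ρ (Ad t) (((ρ Y : V →ₗ[ℂ] V) ^ n) u))), hB.emb w⟫_ℂ +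
            ⟪hB.U ρ K Y t (hB.emb (((ρ Y : V →ₗ[ℂ] V) ^ n) u)), hB.emb (ρ X w)⟫_ℂ‖ := by rw [hiter]
      _ ≤ ‖hB.emb (ρ (Ad t) (((ρ Y : V →ₗ[ℂ] V) ^ n) u))‖ * ‖hB.emb w‖ + ‖hB.emb (((ρ Y : V →ₗ[ℂ] V) ^ n) u)‖ * ‖hB.emb (ρ X w)‖ := by
          refine (norm_add_le _ _).trans (add_le_add ?_ ?_)
          · rw [← hU1]; exact norm_inner_le_norm _ _
          · rw [← hU2]; exact norm_inner_le_norm _ _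
      _ ≤ C * (n + 1)! * K ^ (n + 1) * (NR * ‖(Y : Matrix N N A)‖ ^ n) * ‖hB.emb w‖ + C' * n ! * L ^ n * ‖hB.emb (ρ X w)‖ := by
          gcongr
          exact hword.trans (by gcongr)
      _ = n ! * L ^ n * ((n + 1) * (C * K * NR * ‖hB.emb w‖) + C' * ‖hB.emb (ρ X w)‖) := by
          rw [hfac, hL, pow_succ, mul_pow]; ring
      _ ≤ n ! * L ^ n * ((n + 1) * (C * K * NR * ‖hB.emb w‖ + C' * ‖hB.emb (ρ X w)‖)) := by
          apply mul_le_mul_of_nonneg_left _ (by positivity)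
          have h1 : (0 : ℝ) ≤ C' * ‖hB.emb (ρ X w)‖ := by positivity
          nlinarith [mul_nonneg (Nat.cast_nonneg (α := ℝ) n) h1]
      _ = ((n + 1) * L ^ n) * (n ! * (C * K * NR * ‖hB.emb w‖ + C' * ‖hB.emb (ρ X w)‖)) := by ring
      _ ≤ (2 * L + 1) ^ n * (n ! * (C * K * NR * ‖hB.emb w‖ + C' * ‖hB.emb (ρ X w)‖)) :=
          mul_le_mul_of_nonneg_right (succ_mul_pow_le_pow L hL0 n) (by positivity)
      _ = (C * K * NR * ‖hB.emb w‖ + C' * ‖hB.emb (ρ X w)‖) * n ! / r ^ n := by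
          rw [hr, inv_pow, div_eq_mul_inv, inv_inv]; ring
  -- (iii) Taylor flatness on `(−R, R)`
  have hflat := Literature.Analysis.Calculus.eqOn_zero_of_hasDerivAt_family_of_factorial_bound isOpen_Ioo isPreconnected_Ioo
    (s₀ := 0) (by constructor <;> linarith [abs_nonneg s]) f (fun x => ρ Y x) (fun u t _ => hder u t) hr0 hbd h0 v
  exact hflat hsR

end IsPosDefHerm

end Literature.NumberTheory.Automorphic

end
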